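import Summits.ResolutionOfSingularities.ResolutionOfSingularities.Theorems.MarkedTransferCampaignW13RFlatCanonicalPosSurfaceAllP
import Summits.ResolutionOfSingularities.ResolutionOfSingularities.Theorems.MarkedTransferCampaignW13RFlatCanonicalPosCoordChange
import HarnessLib

/-!
# [OURS · L1 W1.3] Surfaces, every characteristic (part 4): row 2(b) SURVIVES at the origin of `g_p` via the NON-canonical
# representative `u + x³L^{p−2}` — uniformly in `p`, exactly as at g2's S (seat res-L1-s13-pv-1, g3)

LADDER-RESOLUTION rung L (rescue), cell `res-hironaka`, RESCUE-SEED slot W1.3 (architecture bypass, reading R-flat), F7′ rows 1 / 2(b).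
For the uniform surface family of p514228 / p515380, `g_p = u^p + M^p + L^{p−1}F^{p−1}` (`L = y − x`, `F = L^p + x^{2p+1}`,
`M = x³L^{p−2}`, `p = k + 2`), the CANONICAL tail `u` fails POS for every `p` (row 1, chain level). This file shows that the
cotangent-level feed (F7′ row 2(b), o2's schema `Campaign.CampaignW13Eq125Flat`, p483384) is nevertheless RE-FED at the origin for
every `p`, through the non-canonical representative `v = u + M ≡ u (mod 𝔪₀²)`: `v^p = u^p + M^p = g_p − L^{p−1}F^{p−1}` and
`F^{p−1} = ((p−1)!)⁻¹·∂_y^{p−1} g_p ∈ Diff^{(p−1)}((g_p))` (`∂_y F = ∂_y M^p = ∂_y u^p = 0` in characteristic `p`,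
`∂_y^{p−1} L^{p−1} = (p−1)!`), so `v^p ∈ ℘_alg(((g_p),p),1)` (`surfAllP_shiftedTail_pow_mem`) and, GIVEN the (107)-type hypothesis for
`v` (row 081 `Thm14_2_eq107`, a CANDIDATE consumed as a hypothesis), `CampaignW13Eq125Flat 1 L0inf ℘₁ 𝔪₀ {u}` holds
(`surfAllP_CampaignW13Eq125Flat_tail_of_eq107`) — the exact picture of p503641 at S (`p = 2`, `v = u + x₁³`), now for all `p`.
So in the family the two F7′ rows separate uniformly: row 1 (chain-level, canonical) DEAD, row 2(b) (cotangent datum mod `𝔪²`)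
ALIVE; only Narasimhan-type points (p501051 §4) kill 2(b). Generic tool: iterated partial derivatives are differential operators
of the expected order (`isDiffOpLE_pderiv_pow`, tree `IsDiffOpLE.comp` / `Derivation.isDiffOpLE_one`, EGA IV₄ 16.8.9).

HONEST FRAMING. OURS statements about the OURS bypass objects (bound algebraic `℘`, row 003 U17_2); nothing here is a statement
of H. Hironaka's manuscript [Hironaka2017] (2017-03-23, lit key `paper:url-3343fd9e678b`); no claim about resolution of
singularities in positive characteristic; AI bookkeeping weaker than expert review. Caveat of record: nothing here bears on L-G4 /
(127). All decls `[folklore]`, sorry-free.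
-/

noncomputable section

set_option linter.dupNamespace false -- mandated namespace of this single-conjunct summit

namespace Summit.ResolutionOfSingularities.ResolutionOfSingularities.Theorems.Campaign.W13

open MvPolynomial
open Literature.AlgebraicGeometry.Resolution
open Literature.AlgebraicGeometry.Hironaka2017
open Literature.AlgebraicGeometry.Hironaka2017.S11CoordFree (BlSub)

/-! ## §1 Iterated partial derivatives as differential operators -/

section Iterate

variable (K : Type) [Field K] {σ : Type}

/-- `∂_i^n` (the `n`-th power of the derivation `∂_i` in `End_K K[x_σ]`) is a differential operator of order `≤ n`
(EGA IV₄ 16.8.9 by induction). [folklore] -/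
theorem isDiffOpLE_pderiv_pow (i : σ) (n : ℕ) :
    IsDiffOpLE K n (((pderiv i : Derivation K (MvPolynomial σ K) (MvPolynomial σ K)) :
      MvPolynomial σ K →ₗ[K] MvPolynomial σ K) ^ n) := by
  induction n with
  | zero =>
    rw [pow_zero, Module.End.one_eq_id]
    exact isDiffOpLE_id
  | succ n ih =>
    rw [pow_succ, Module.End.mul_eq_comp]
    exact ih.comp (Derivation.isDiffOpLE_one _)

/-- Hence `∂_i^n g ∈ Diff^{(n)}((g))`. [folklore] -/
theorem pderiv_pow_apply_mem_diffIdeal (i : σ) (n : ℕ) (g : MvPolynomial σ K) :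
    (((pderiv i : Derivation K (MvPolynomial σ K) (MvPolynomial σ K)) :
      MvPolynomial σ K →ₗ[K] MvPolynomial σ K) ^ n) g ∈ diffIdeal K n (Ideal.span {g}) :=
  apply_mem_diffIdeal K (isDiffOpLE_pderiv_pow K i n) (Ideal.subset_span rfl)

/-- Iterating a derivation `∂_i` on `c · L^m · G` with `∂_i L = 1`, `∂_i G = 0`, `∂_i c = 0`:
`∂_i^j (c·L^m·G) = c·m(m−1)⋯(m−j+1)·L^{m−j}·G`. [folklore] -/
theorem pderiv_pow_apply_mul_pow_mul (i : σ) (c L G : MvPolynomial σ K) (hc : pderiv i c = 0) (hL : pderiv i L = 1)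
    (hG : pderiv i G = 0) (m j : ℕ) :
    (((pderiv i : Derivation K (MvPolynomial σ K) (MvPolynomial σ K)) :
      MvPolynomial σ K →ₗ[K] MvPolynomial σ K) ^ j) (c * L ^ m * G) =
        c * ((m.descFactorial j : ℕ) : MvPolynomial σ K) * L ^ (m - j) * G := by
  induction j with
  | zero => simp
  | succ j ih =>
    rw [pow_succ', Module.End.mul_apply, ih]
    change pderiv i _ = _
    rw [pderiv_mul, hG, mul_zero, add_zero, pderiv_mul, pderiv_mul, hc, zero_mul, zero_add, Derivation.map_natCast,
      mul_zero, zero_mul, zero_add, pderiv_pow, hL, mul_one, Nat.descFactorial_succ, ← Nat.sub_sub]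
    push_cast
    ring

end Iterate

/-! ## §2 `∂_y^{p−1} g_p = (p−1)!·F^{p−1}` and the shifted tail -/

section Row2b

variable (K : Type) [Field K] (k : ℕ) [hp : Fact (k + 2).Prime] [CharP K (k + 2)]

omit hp in
/-- `∂_y F = 0` for `F = (y−x)^p + x^{2p+1}` in characteristic `p = k+2`. [folklore] -/
theorem surfAllP_pderiv_F :
    pderiv 1 (((X 1 : MvPolynomial (Fin 3) K) - X 0) ^ (k + 2) + X 0 ^ (2 * k + 5)) = 0 := by
  have hc : ((k + 2 : ℕ) : MvPolynomial (Fin 3) K) = 0 := CharP.cast_eq_zero _ (k + 2)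
  rw [map_add, pderiv_pow, hc, zero_mul, zero_mul, zero_add, pderiv_pow,
    pderiv_X_of_ne (show (0 : Fin 3) ≠ 1 by decide), mul_zero]

omit hp in
/-- **`∂_y^{p−1} g_p = (p−1)!·F^{p−1}`**. [folklore] -/
theorem surfAllP_pderiv_pow_head :
    (((pderiv 1 : Derivation K (MvPolynomial (Fin 3) K) (MvPolynomial (Fin 3) K)) :
      MvPolynomial (Fin 3) K →ₗ[K] MvPolynomial (Fin 3) K) ^ (k + 1))
        (X 2 ^ (k + 2) + ((X 0 ^ 3 * (X 1 - X 0) ^ k) ^ (k + 2) +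
          (X 1 - X 0) ^ (k + 1) * ((X 1 - X 0) ^ (k + 2) + X 0 ^ (2 * k + 5)) ^ (k + 1)) : MvPolynomial (Fin 3) K) =
      (((k + 1).factorial : ℕ) : MvPolynomial (Fin 3) K) * ((X 1 - X 0) ^ (k + 2) + X 0 ^ (2 * k + 5)) ^ (k + 1) := by
  have hc : ((k + 2 : ℕ) : MvPolynomial (Fin 3) K) = 0 := CharP.cast_eq_zero _ (k + 2)
  -- the derivation kills `u^p`, `M^p` and `F^{p−1}`
  have h10 : (0 : Fin 3) ≠ 1 := by decide
  have h21 : (2 : Fin 3) ≠ 1 := by decide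
  have du : pderiv 1 ((X 2 : MvPolynomial (Fin 3) K) ^ (k + 2)) = 0 := by
    rw [pderiv_pow, pderiv_X_of_ne h21, mul_zero]
  have dM : pderiv 1 (((X 0 : MvPolynomial (Fin 3) K) ^ 3 * (X 1 - X 0) ^ k) ^ (k + 2)) = 0 := by
    rw [pderiv_pow, hc, zero_mul, zero_mul]
  have dG : pderiv 1 ((((X 1 : MvPolynomial (Fin 3) K) - X 0) ^ (k + 2) + X 0 ^ (2 * k + 5)) ^ (k + 1)) = 0 := by
    rw [pderiv_pow, surfAllP_pderiv_F, mul_zero]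
  have dL : pderiv 1 ((X 1 : MvPolynomial (Fin 3) K) - X 0) = 1 := by
    rw [map_sub, pderiv_X_self, pderiv_X_of_ne h10, sub_zero]
  -- iterates of a derivation on something it kills vanish
  have kill : ∀ (x : MvPolynomial (Fin 3) K), pderiv 1 x = 0 → ∀ j, 0 < j →
      (((pderiv 1 : Derivation K (MvPolynomial (Fin 3) K) (MvPolynomial (Fin 3) K)) :
        MvPolynomial (Fin 3) K →ₗ[K] MvPolynomial (Fin 3) K) ^ j) x = 0 := by
    intro x hx j hj
    obtain ⟨j, rfl⟩ : ∃ j', j = j' + 1 := ⟨j - 1, by omega⟩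
    rw [pow_succ, Module.End.mul_apply]
    change (((pderiv 1 : Derivation K (MvPolynomial (Fin 3) K) (MvPolynomial (Fin 3) K)) :
      MvPolynomial (Fin 3) K →ₗ[K] MvPolynomial (Fin 3) K) ^ j) (pderiv 1 x) = 0
    rw [hx, map_zero]
  have main := pderiv_pow_apply_mul_pow_mul K (1 : Fin 3) 1 (X 1 - X 0)
    ((((X 1 : MvPolynomial (Fin 3) K) - X 0) ^ (k + 2) + X 0 ^ (2 * k + 5)) ^ (k + 1)) (by simp) dL dG (k + 1) (k + 1)
  rw [one_mul, Nat.descFactorial_self, Nat.sub_self, pow_zero, mul_one] at main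
  rw [map_add, map_add, kill _ du (k + 1) (Nat.succ_pos k), kill _ dM (k + 1) (Nat.succ_pos k), zero_add, zero_add, main,
    one_mul]

/-- Hence `F^{p−1} ∈ Diff^{(p−1)}((g_p))` (`(p−1)!` is a unit). [folklore] -/
theorem surfAllP_F_pow_mem_diffIdeal :
    ((((X 1 : MvPolynomial (Fin 3) K) - X 0) ^ (k + 2) + X 0 ^ (2 * k + 5)) ^ (k + 1)) ∈
      diffIdeal K (k + 1) (Ideal.span {(X 2 ^ (k + 2) + ((X 0 ^ 3 * (X 1 - X 0) ^ k) ^ (k + 2) +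
        (X 1 - X 0) ^ (k + 1) * ((X 1 - X 0) ^ (k + 2) + X 0 ^ (2 * k + 5)) ^ (k + 1)) : MvPolynomial (Fin 3) K)}) := by
  have hfac : (((k + 1).factorial : ℕ) : K) ≠ 0 := by
    rw [Ne, CharP.cast_eq_zero_iff K (k + 2), hp.out.dvd_factorial]
    omega
  have h := Ideal.mul_mem_left _ (C ((((k + 1).factorial : ℕ) : K)⁻¹)) (pderiv_pow_apply_mem_diffIdeal K (1 : Fin 3) (k + 1)
    (X 2 ^ (k + 2) + ((X 0 ^ 3 * (X 1 - X 0) ^ k) ^ (k + 2) +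
      (X 1 - X 0) ^ (k + 1) * ((X 1 - X 0) ^ (k + 2) + X 0 ^ (2 * k + 5)) ^ (k + 1)) : MvPolynomial (Fin 3) K))
  rwa [surfAllP_pderiv_pow_head, ← mul_assoc, ← map_natCast (C : K →+* MvPolynomial (Fin 3) K), ← map_mul,
    inv_mul_cancel₀ hfac, map_one, one_mul] at h

/-- **POS for the NON-canonical representative** `v = u + x³L^{p−2}`: `v^p = g_p − L^{p−1}F^{p−1} ∈ ℘_alg(((g_p),p),1)` for every
prime `p = k+2`. [folklore] -/
theorem surfAllP_shiftedTail_pow_mem :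
    (X 2 + X 0 ^ 3 * (X 1 - X 0) ^ k : MvPolynomial (Fin 3) K) ^ (k + 2) ∈
      Campaign.pAlgPiece K (Ideal.span {(X 2 ^ (k + 2) + ((X 0 ^ 3 * (X 1 - X 0) ^ k) ^ (k + 2) +
        (X 1 - X 0) ^ (k + 1) * ((X 1 - X 0) ^ (k + 2) + X 0 ^ (2 * k + 5)) ^ (k + 1)) : MvPolynomial (Fin 3) K)})
        (k + 2) 1 := by
  refine pow_mem_pAlgPiece_one_of_sub_mem_diffIdeal K _ (Nat.succ_pos _) (Nat.lt_succ_self (k + 1))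
    (Ideal.subset_span rfl) ?_
  have e : (X 2 ^ (k + 2) + ((X 0 ^ 3 * (X 1 - X 0) ^ k) ^ (k + 2) +
        (X 1 - X 0) ^ (k + 1) * ((X 1 - X 0) ^ (k + 2) + X 0 ^ (2 * k + 5)) ^ (k + 1)) : MvPolynomial (Fin 3) K) -
      (X 2 + X 0 ^ 3 * (X 1 - X 0) ^ k) ^ (k + 2) =
      (X 1 - X 0) ^ (k + 1) * ((X 1 - X 0) ^ (k + 2) + X 0 ^ (2 * k + 5)) ^ (k + 1) := by
    rw [add_pow_char (X 2 : MvPolynomial (Fin 3) K) _ (k + 2)]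
    ring
  rw [e]
  exact Ideal.mul_mem_left _ _ (surfAllP_F_pow_mem_diffIdeal K k)

/-- **Row 2(b) is RE-FED at the origin of `g_p`, every `p`** (o2's schema `CampaignW13Eq125Flat`, level `e = 1`, `P1 = ℘_alg`
bound, `𝔪 = 𝔪₀`, cotangent datum `V = {u}`): GIVEN the (107)-type hypothesis for the representative `v = u + x³L^{p−2}` (row 081
`Thm14_2_eq107`, a CANDIDATE consumed as a hypothesis: `ρ(v) ∈ ∥𝔏₀(∞)∥`), `v ∈ Cot_flat` and `v − u ∈ 𝔪₀²`. [folklore] -/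
theorem surfAllP_CampaignW13Eq125Flat_tail_of_eq107 {ℓ : ℕ} (L0inf : BlSub (MvPolynomial (Fin 3) K) (k + 2) ℓ)
    (h107 : iterateFrobenius (MvPolynomial (Fin 3) K) (k + 2) 1 (X 2 + X 0 ^ 3 * (X 1 - X 0) ^ k) ∈
      S12GLUED.fnorm (↥(iterateFrobenius (MvPolynomial (Fin 3) K) (k + 2) ℓ).range) L0inf) :
    CampaignW13Eq125Flat 1 L0inf
      (Campaign.pAlgPiece K (Ideal.span {(X 2 ^ (k + 2) + ((X 0 ^ 3 * (X 1 - X 0) ^ k) ^ (k + 2) +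
        (X 1 - X 0) ^ (k + 1) * ((X 1 - X 0) ^ (k + 2) + X 0 ^ (2 * k + 5)) ^ (k + 1)) : MvPolynomial (Fin 3) K)}) (k + 2) 1)
      (idealOfVars (Fin 3) K) {(X 2 : MvPolynomial (Fin 3) K)} := by
  intro v hv
  rw [Set.mem_singleton_iff] at hv
  subst hv
  refine ⟨X 2 + X 0 ^ 3 * (X 1 - X 0) ^ k, (mem_bypassCotRFlat_iff 1 L0inf _ _).mpr ⟨h107, ?_⟩, ?_⟩
  · rw [pow_one]
    exact surfAllP_shiftedTail_pow_mem K k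
  · have hX : ∀ i : Fin 3, (X i : MvPolynomial (Fin 3) K) ∈ idealOfVars (Fin 3) K :=
      fun i => Ideal.subset_span (Set.mem_range_self i)
    have e : (X 0 ^ 3 * (X 1 - X 0) ^ k : MvPolynomial (Fin 3) K) = X 0 * X 0 * (X 0 * (X 1 - X 0) ^ k) := by ring
    rw [add_sub_cancel_left, e, pow_two]
    exact Ideal.mul_mem_right _ _ (Ideal.mul_mem_mul (hX 0) (hX 0))

end Row2b

end Summit.ResolutionOfSingularities.ResolutionOfSingularities.Theorems.Campaign.W13

end
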